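import Mathlib
import HarnessLib
import Summits.NavierStokesRegularity.NavierStokesRegularity.Theorems.TypeIQuarterGateScarEnvelopeTypeIForcedTsaiAlgSemantics

/-!
# ARM B lane E-exact, Type-I-tail class — the NORMAL FORM and the TWO WEIGHTS at the value level
  (`nf` is value-preserving for `τ ≠ 0`; `tPow/expandT`; `⟪evalVec5 V, evalVec5 V'⟫` as a symbolic sum;
  `floorPoly` = `(1 − (|y|²/100)^m)(1 − (1−v²)^k)^m ≤ 𝟙_{B₁₀}`; `majorPoly ≥ (1+|y|)⁵` by AM-GM)

Second half of the semantics layer of the LANEX-ALG soundness chain (`…AlgSemantics` holds the definitions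
and the list-algebra value lemmas).  Nothing here bears on NS regularity.
-/

noncomputable section

set_option linter.dupNamespace false

namespace Summit.NavierStokesRegularity.NavierStokesRegularity.Cruxes.ScarEnvelopeTypeI.ForcedTsai

open MeasureTheory Set Metric Real
open scoped RealInnerProductSpace ContDiff
open Literature.Analysis.FluidPDE

/-! ## The normal form -/

/-- One rewrite step preserves the value (`τ ≠ 0`; `τ2 = τ²`). -/
theorem Mono5.eval_nfStep {τ : ℝ} {τ2 : ℚ} (hτ : τ ≠ 0) (hτ2 : (τ2 : ℝ) = τ ^ 2) (m : Mono5) (Q : Poly5)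
    (h : m.nfStep τ2 = some Q) (y : E3) : Poly5.eval τ Q y = Mono5.eval τ m y := by
  unfold Mono5.nfStep at h
  split_ifs at h with h3 ht
  · cases h
    obtain ⟨k, hk⟩ : ∃ k, m.e3 = k + 2 := ⟨m.e3 - 2, by omega⟩
    simp only [Poly5.eval_cons, Poly5.eval_nil, Mono5.eval, hk, Nat.add_sub_cancel, pow_add, pow_one]
    have h2 : ‖y‖ ^ 2 - y 0 ^ 2 - y 1 ^ 2 = y 2 ^ 2 := (coord_two_sq y).symm
    push_cast
    linear_combination ((m.c : ℝ) * y 0 ^ m.e1 * y 1 ^ m.e2 * y 2 ^ k * (‖y‖ ^ 2) ^ m.et * vpow τ m.eh y) * h2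
  · cases h
    obtain ⟨ht1, hh⟩ := ht
    obtain ⟨k, hk⟩ : ∃ k, m.et = k + 1 := ⟨m.et - 1, by omega⟩
    obtain ⟨l, hl⟩ : ∃ l, m.eh = l + 2 := ⟨m.eh - 2, by omega⟩
    simp only [Poly5.eval_cons, Poly5.eval_nil, Mono5.eval, hk, hl, Nat.add_sub_cancel, pow_add, pow_one, vpow_add]
    have key := norm_sq_mul_vpow_two hτ y
    push_cast
    rw [hτ2]
    linear_combination (-((m.c : ℝ) * y 0 ^ m.e1 * y 1 ^ m.e2 * y 2 ^ m.e3 * (‖y‖ ^ 2) ^ k * vpow τ l y)) * key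

/-- The normal form preserves the value (`τ ≠ 0`; `τ2 = τ²`). -/
theorem Poly5.eval_nf {τ : ℝ} {τ2 : ℚ} (hτ : τ ≠ 0) (hτ2 : (τ2 : ℝ) = τ ^ 2) (fuel : ℕ) (P : Poly5) (y : E3) :
    Poly5.eval τ (Poly5.nf τ2 fuel P) y = Poly5.eval τ P y := by
  induction fuel generalizing P with
  | zero => rfl
  | succ fuel ih =>
    rw [Poly5.nf, Poly5.eval_flatMap]
    unfold Poly5.eval
    congr 1
    refine List.map_congr_left fun m _ => ?_
    rcases hQ : m.nfStep τ2 with _ | Q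
    · simp
    · simp only []
      rw [show (List.map (fun m => Mono5.eval τ m y) (nf τ2 fuel Q)).sum = Poly5.eval τ (nf τ2 fuel Q) y from rfl,
        ih Q, Mono5.eval_nfStep hτ hτ2 m Q hQ y]

/-! ## `t`-powers and `expandT` -/

/-- `tPoly5` is `|y|²`. -/
theorem Poly5.eval_tPoly5 (τ : ℝ) (y : E3) : Poly5.eval τ Poly5.tPoly5 y = ‖y‖ ^ 2 := by
  rw [EuclideanSpace.real_norm_sq_eq, Fin.sum_univ_three]
  simp [Poly5.eval, Poly5.tPoly5, Mono5.eval]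
  ring

/-- `tPow` unfolds one step. -/
theorem Poly5.tPow_succ (n : ℕ) : Poly5.tPow (n + 1) = Poly5.nmul (Poly5.tPow n) Poly5.tPoly5 := rfl

/-- `tPow n` is `|y|^{2n}`. -/
theorem Poly5.eval_tPow (τ : ℝ) (n : ℕ) (y : E3) : Poly5.eval τ (Poly5.tPow n) y = (‖y‖ ^ 2) ^ n := by
  induction n with
  | zero => simp [Poly5.tPow, Poly5.eval, Mono5.eval]
  | succ n ih => rw [Poly5.tPow_succ, Poly5.eval_nmul, ih, Poly5.eval_tPoly5, pow_succ (‖y‖ ^ 2) n]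

/-- Setting `et := 0` divides off the `t`-power. -/
theorem Mono5.eval_et_zero (τ : ℝ) (m : Mono5) (y : E3) :
    Mono5.eval τ { m with et := 0 } y * (‖y‖ ^ 2) ^ m.et = Mono5.eval τ m y := by
  simp only [Mono5.eval, pow_zero, mul_one]; ring

/-- `expandT` preserves the value. -/
theorem Poly5.eval_expandT (τ : ℝ) (P : Poly5) (y : E3) : Poly5.eval τ (Poly5.expandT P) y = Poly5.eval τ P y := by
  rw [Poly5.expandT, Poly5.eval_norm, Poly5.eval_flatMap]
  unfold Poly5.eval
  congr 1
  refine List.map_congr_left fun m _ => ?_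
  rw [show (List.map (fun m' => Mono5.eval τ m' y) (List.map (Mono5.mul { m with et := 0 }) (tPow m.et))).sum =
      Poly5.eval τ ((tPow m.et).map (Mono5.mul { m with et := 0 })) y from rfl,
    Poly5.eval_map_mul, Poly5.eval_tPow, Mono5.eval_et_zero]

/-! ## Inner products and the two weights -/

/-- The inner product of two symbolic vector fields is the value of the symbolic dot product. -/
theorem inner_evalVec5 (τ : ℝ) (V V' : Fin 3 → Poly5) (y : E3) :
    ⟪evalVec5 τ V y, evalVec5 τ V' y⟫ =
      Poly5.eval τ (Poly5.add (Poly5.add (Poly5.nmul (V 0) (V' 0)) (Poly5.nmul (V 1) (V' 1))) (Poly5.nmul (V 2) (V' 2))) y := by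
  have : ⟪evalVec5 τ V y, evalVec5 τ V' y⟫ = ∑ i : Fin 3, Poly5.eval τ (V i) y * Poly5.eval τ (V' i) y := by
    simp [evalVec5, PiLp.inner_apply, mul_comm]
  rw [this, Fin.sum_univ_three]
  simp

/-! ## The two weights -/

/-- A single `t`-monomial. -/
theorem eval_tMono (τ : ℝ) (n : ℕ) (c : ℚ) (y : E3) : Mono5.eval τ (tMono n c) y = (c : ℝ) * (‖y‖ ^ 2) ^ n := by
  simp [tMono, Mono5.eval]

/-- Value of the even weight majorant. -/
theorem eval_majorPoly (τ : ℝ) (r1 r3 r5 : ℚ) (y : E3) :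
    Poly5.eval τ (majorPoly r1 r3 r5) y =
      1 + 10 * ‖y‖ ^ 2 + 5 * (‖y‖ ^ 2) ^ 2 +
        5 * (((r1 : ℝ) + ‖y‖ ^ 2 / r1) / 2) + 10 * (((r3 : ℝ) * ‖y‖ ^ 2 + (‖y‖ ^ 2) ^ 2 / r3) / 2) +
          ((r5 : ℝ) * (‖y‖ ^ 2) ^ 2 + (‖y‖ ^ 2) ^ 3 / r5) / 2 := by
  rw [majorPoly, Poly5.eval_norm]
  simp only [Poly5.eval_cons, Poly5.eval_nil, eval_tMono]
  push_cast
  ring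

/-- AM-GM for an odd power: `ρ^{2i+1} ≤ (r ρ^{2i} + ρ^{2i+2}/r)/2` for `r > 0` (any real `ρ`). -/
theorem pow_odd_le_amgm (ρ : ℝ) {r : ℝ} (hr : 0 < r) (i : ℕ) :
    ρ ^ (2 * i + 1) ≤ (r * (ρ ^ 2) ^ i + (ρ ^ 2) ^ (i + 1) / r) / 2 := by
  have hx : 0 ≤ (ρ ^ 2) ^ i := by positivity
  have h1 : ρ ≤ (r + ρ ^ 2 / r) / 2 := by
    rw [← sub_nonneg]
    have : (r + ρ ^ 2 / r) / 2 - ρ = (r - ρ) ^ 2 / (2 * r) := by field_simp; ring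
    rw [this]; positivity
  calc ρ ^ (2 * i + 1) = (ρ ^ 2) ^ i * ρ := by rw [pow_succ, pow_mul]
    _ ≤ (ρ ^ 2) ^ i * ((r + ρ ^ 2 / r) / 2) := mul_le_mul_of_nonneg_left h1 hx
    _ = (r * (ρ ^ 2) ^ i + (ρ ^ 2) ^ (i + 1) / r) / 2 := by ring

/-- **The even weight majorant**: `(1+|y|)⁵ ≤ m(y)` for positive radii. -/
theorem pow_five_le_majorPoly (τ : ℝ) {r1 r3 r5 : ℚ} (h1 : 0 < r1) (h3 : 0 < r3) (h5 : 0 < r5) (y : E3) :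
    (1 + ‖y‖) ^ 5 ≤ Poly5.eval τ (majorPoly r1 r3 r5) y := by
  rw [eval_majorPoly]
  have a1 := pow_odd_le_amgm ‖y‖ (by exact_mod_cast h1 : (0:ℝ) < r1) 0
  have a3 := pow_odd_le_amgm ‖y‖ (by exact_mod_cast h3 : (0:ℝ) < r3) 1
  have a5 := pow_odd_le_amgm ‖y‖ (by exact_mod_cast h5 : (0:ℝ) < r5) 2
  norm_num at a1 a3 a5
  have e : (1 + ‖y‖) ^ 5 = 1 + 5 * ‖y‖ + 10 * ‖y‖ ^ 2 + 10 * ‖y‖ ^ 3 + 5 * (‖y‖ ^ 2) ^ 2 + ‖y‖ ^ 5 := by ring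
  rw [e]
  nlinarith [a1, a3, a5]

/-- An iterated `nmul` evaluates to a power. -/
theorem Poly5.eval_rec_nmul (τ : ℝ) (one Q : Poly5) (hone : ∀ y, Poly5.eval τ one y = 1) (n : ℕ) (y : E3) :
    Poly5.eval τ (Nat.rec one (fun _ P => Poly5.nmul P Q) n : Poly5) y = (Poly5.eval τ Q y) ^ n := by
  induction n with
  | zero => simp [hone]
  | succ n ih => simp only []; rw [Poly5.eval_nmul, ih, pow_succ]

/-- Value of the level floor: `φ = (1 − (|y|²/100)^m)·(1 − (1 − v²)^k)^m` (`τ ≠ 0`, `τ2 = τ²`). -/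
theorem eval_floorPoly {τ : ℝ} {τ2 : ℚ} (hτ : τ ≠ 0) (hτ2 : (τ2 : ℝ) = τ ^ 2) (m k : ℕ) (y : E3) :
    Poly5.eval τ (floorPoly τ2 m k) y = (1 - (‖y‖ ^ 2 / 100) ^ m) * (1 - (1 - vpow τ 2 y) ^ k) ^ m := by
  have hone : ∀ y, Poly5.eval τ ([⟨0, 0, 0, 0, 0, 1⟩] : Poly5) y = 1 := fun y => by simp [Poly5.eval, Mono5.eval]
  rw [floorPoly]
  rw [Poly5.eval_norm, Poly5.eval_nf hτ hτ2, Poly5.eval_nmul, Poly5.eval_rec_nmul τ _ _ hone, Poly5.eval_sub,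
    Poly5.eval_rec_nmul τ _ _ hone, Poly5.eval_add, hone]
  simp only [Poly5.eval_cons, Poly5.eval_nil, eval_tMono]
  simp only [Mono5.eval, vpow_zero]
  push_cast
  simp only [pow_zero, mul_one, one_mul, add_zero, neg_mul, one_div]
  rw [div_pow, ← sub_eq_add_neg, ← sub_eq_add_neg, div_eq_mul_inv, mul_comm ((‖y‖ ^ 2) ^ m)]

/-- **The level floor is below the indicator of `B₁₀`**: `φ·X ≤ 𝟙_{B₁₀}·X` for `X ≥ 0`. -/
theorem floorPoly_mul_le {τ : ℝ} {τ2 : ℚ} (hτ : τ ≠ 0) (hτ2 : (τ2 : ℝ) = τ ^ 2) (m k : ℕ)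
    (y : E3) {X : ℝ} (hX : 0 ≤ X) :
    Poly5.eval τ (floorPoly τ2 m k) y * X ≤ (ball (0 : E3) 10).indicator (fun _ => (1 : ℝ)) y * X := by
  rw [eval_floorPoly hτ hτ2]
  have hv0 : 0 ≤ 1 - vpow τ 2 y := by linarith [vpow_le_one τ 2 y]
  have hv1 : 1 - vpow τ 2 y ≤ 1 := by linarith [vpow_pos τ 2 y]
  have hk1 : (1 - vpow τ 2 y) ^ k ≤ 1 := pow_le_one₀ (n := k) hv0 hv1
  have hk0 : 0 ≤ (1 - vpow τ 2 y) ^ k := pow_nonneg hv0 k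
  have hB0 : 0 ≤ (1 - (1 - vpow τ 2 y) ^ k) ^ m := pow_nonneg (by linarith) _
  have hB1 : (1 - (1 - vpow τ 2 y) ^ k) ^ m ≤ 1 := pow_le_one₀ (n := m) (by linarith) (by linarith)
  by_cases hy : y ∈ ball (0 : E3) 10
  · rw [indicator_of_mem hy, one_mul]
    have hy' : ‖y‖ < 10 := by simpa [mem_ball, dist_zero_right] using hy
    have hA1 : 1 - (‖y‖ ^ 2 / 100) ^ m ≤ 1 := by linarith [pow_nonneg (by positivity : (0:ℝ) ≤ ‖y‖ ^ 2 / 100) m]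
    have hA0 : 0 ≤ 1 - (‖y‖ ^ 2 / 100) ^ m := by
      have : ‖y‖ ^ 2 / 100 ≤ 1 := by rw [div_le_one (by norm_num)]; nlinarith [norm_nonneg y]
      linarith [pow_le_one₀ (n := m) (by positivity : (0:ℝ) ≤ ‖y‖ ^ 2 / 100) this]
    calc (1 - (‖y‖ ^ 2 / 100) ^ m) * (1 - (1 - vpow τ 2 y) ^ k) ^ m * X ≤ 1 * 1 * X := by gcongr
      _ = X := by ring
  · rw [indicator_of_notMem hy, zero_mul]
    have hy' : 10 ≤ ‖y‖ := by simpa [mem_ball, dist_zero_right] using hy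
    have hA : 1 - (‖y‖ ^ 2 / 100) ^ m ≤ 0 := by
      have : 1 ≤ ‖y‖ ^ 2 / 100 := by rw [le_div_iff₀ (by norm_num)]; nlinarith
      linarith [one_le_pow₀ (M₀ := ℝ) this (n := m)]
    have : (1 - (‖y‖ ^ 2 / 100) ^ m) * (1 - (1 - vpow τ 2 y) ^ k) ^ m ≤ 0 := mul_nonpos_of_nonpos_of_nonneg hA hB0
    exact mul_nonpos_of_nonpos_of_nonneg this hX

end Summit.NavierStokesRegularity.NavierStokesRegularity.Cruxes.ScarEnvelopeTypeI.ForcedTsai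

end
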